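import Summits.ResolutionOfSingularities.ResolutionOfSingularities.Theorems.PAlterationPialtTameKnownCases
import Literature.AlgebraicGeometry.Resolution.ProperModels
import Mathlib.FieldTheory.Perfect
import Mathlib.RingTheory.EssentialFiniteness
import HarnessLib

/-!
# Route `PAlteration`, crux `Pialt` — definitions posited by the line `radicially-regular-endgame`

Route `ResolutionOfSingularities/PAlteration`, crux `Pialt` (stmt-ResolutionOfSingularities-0555),
line `SketchIdeator2` / Card A (`Cruxes/Pialt/Lines/SketchIdeator2.lean`), stub
`stub_tameResolution` and its plan `Cruxes/Pialt/STUB-PLAN-stub_tameResolution.md`. Two names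
for statements that the line's theorems (`Theorems/PAlterationPialtTame*.lean`) otherwise carry
INLINED, so that the exact residual of the stub can be registered and attacked by name:

* `TameResolutionInChar p` — **tame resolution in characteristic `p`** (`TameResolution_p`, the
  statement of the registered stub `stub_tameResolution` at the prime `p`): over every PERFECT
  field `k` of characteristic `p`, every integral separated `k`-scheme of finite type `X` has a
  proper birational `π : Z → X` with `Z` integral, normal (all stalks integrally closed) and
  locally radicially regular (every point has an open neighbourhood onto which an integral
  regular scheme maps finitely, universally injectively and surjectively). A PARTIAL-RESOLUTION
  statement, implied by resolution of singularities in characteristic `p`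
  (`tameResolution_of_resolutionInChar`), open from dimension `4`.
* `TwoModelTamePatching p` — **two-model tame patching in characteristic `p`**, the KERNEL of the
  line: Piltant's two-model patching axiom (Piltant 2013, Prop. 5.1: "there exists a proper model
  `Y` of `K` dominating `X₁` and `X₂` with `πᵢ⁻¹(Reg_P Xᵢ) ⊆ Reg_P Y`") for the predicate
  `P = P_LRR` ("locally radicially regular") in place of `P = P_reg`, over perfect ground fields
  of characteristic `p`: any two proper models `M₁, M₂` (`ProperModel`, `ProperModels.lean`) of
  an essentially-finite-type `K/k` are dominated by a proper model `N` through morphisms `φᵢ`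
  such that every point of `N` lying over an RR open of `Mᵢ` has an RR open neighbourhood. It
  is a consequence of `TameResolutionInChar p` (`twoModelTamePatching_of_tame`, exactness) and,
  under Temkin's inseparable local uniformization `Temkin2013`, EQUIVALENT to it
  (`tame_iff_twoModelTamePatching_of_temkin2013`); open from dimension `4`.

One calibration theorem, `tameResolutionInChar_of_resolutionInChar` (resolution in characteristic
`p` implies `TameResolutionInChar p`: the stub is a consequence of the summit); the named forms
of the line's results (stub from `Temkin2013 ∧ TwoModelTamePatching p`, exactness) are in
`Theorems/PAlterationPialtTameKernel.lean`.
-/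

noncomputable section

open CategoryTheory AlgebraicGeometry TopologicalSpace
open Literature.AlgebraicGeometry.Resolution

set_option linter.dupNamespace false -- mandated namespace of this single-conjunct summit

namespace Summit.ResolutionOfSingularities.ResolutionOfSingularities.Theorems.Pialt.RadiciallyRegular

/-- **Tame resolution in characteristic `p`** (`TameResolution_p`; the statement of the stub
`stub_tameResolution` of the line `radicially-regular-endgame` at the prime `p`): for every
perfect field `k` of characteristic `p` and every integral separated `k`-scheme `X` of finite
type there is a proper birational `π : Z → X` with `Z` integral, all of whose local rings are
integrally closed, and such that every point of `Z` has an open neighbourhood `U` admitting a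
finite, universally injective, surjective morphism `W → U` from an integral regular scheme `W`
(a "tame resolution": partial resolution to the locally radicially regular class). Implied by
resolution of singularities in characteristic `p`; open from dimension `4`. [folklore] -/
def TameResolutionInChar (p : ℕ) : Prop :=
  ∀ (k : Type) [Field k] [CharP k p] [PerfectField k] (X : Scheme.{0}) (f : X ⟶ Spec (.of k)),
    IsSeparated f → LocallyOfFiniteType f → QuasiCompact f → IsIntegral X →
      ∃ (Z : Scheme.{0}) (π : Z ⟶ X), IsProper π ∧ IsBirational π ∧ IsIntegral Z ∧
        (∀ z : Z, IsIntegrallyClosed (Z.presheaf.stalk z)) ∧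
        ∀ z : Z, ∃ U : Z.Opens, z ∈ U ∧ ∃ (W : Scheme.{0}) (h : W ⟶ (U : Scheme.{0})),
          IsIntegral W ∧ Scheme.IsRegular W ∧ IsFinite h ∧ UniversallyInjective h ∧
            Function.Surjective h.base

/-- **Two-model tame patching in characteristic `p`** — Piltant's two-model patching (Piltant
2013, Prop. 5.1: two projective/proper models `X₁, X₂` of `K` are dominated by a proper model
`Y` with `πᵢ⁻¹(Reg_P Xᵢ) ⊆ Reg_P Y`) for the predicate "locally radicially regular" in place of
"regular", over PERFECT ground fields of characteristic `p`: for every perfect field `k` of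
characteristic `p`, every field `K` essentially of finite type over `k` and any two proper
models `M₁, M₂` of `K/k` there are a proper model `N` and morphisms of models `φᵢ : N → Mᵢ` such
that every point of `N` mapping into an open of `Mᵢ` that is dominated finitely, universally
injectively and surjectively by an integral regular scheme has itself such an open
neighbourhood. The kernel of the line `radicially-regular-endgame`: together with `Temkin2013`
it is equivalent to `TameResolutionInChar p`; open from dimension `4`.
[cite: Piltant2013, Prop. 5.1] -/
def TwoModelTamePatching (p : ℕ) : Prop :=
  ∀ (k : Type) [Field k] [CharP k p] [PerfectField k] (K : Type) [Field K] [Algebra k K]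
    [Algebra.EssFiniteType k K], ∀ M₁ M₂ : ProperModel k K,
      ∃ (N : ProperModel k K) (φ₁ : N.Hom M₁) (φ₂ : N.Hom M₂),
      (∀ y : N.X, (∃ U : M₁.X.Opens, φ₁.f.base y ∈ U ∧
        ∃ (W : Scheme.{0}) (h : W ⟶ (U : Scheme.{0})), IsIntegral W ∧ Scheme.IsRegular W ∧
          IsFinite h ∧ UniversallyInjective h ∧ Function.Surjective h.base) →
        ∃ V : N.X.Opens, y ∈ V ∧ ∃ (W : Scheme.{0}) (h : W ⟶ (V : Scheme.{0})),
          IsIntegral W ∧ Scheme.IsRegular W ∧ IsFinite h ∧ UniversallyInjective h ∧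
            Function.Surjective h.base) ∧
      (∀ y : N.X, (∃ U : M₂.X.Opens, φ₂.f.base y ∈ U ∧
        ∃ (W : Scheme.{0}) (h : W ⟶ (U : Scheme.{0})), IsIntegral W ∧ Scheme.IsRegular W ∧
          IsFinite h ∧ UniversallyInjective h ∧ Function.Surjective h.base) →
        ∃ V : N.X.Opens, y ∈ V ∧ ∃ (W : Scheme.{0}) (h : W ⟶ (V : Scheme.{0})),
          IsIntegral W ∧ Scheme.IsRegular W ∧ IsFinite h ∧ UniversallyInjective h ∧
            Function.Surjective h.base)

/-- **Resolution in characteristic `p` implies tame resolution in characteristic `p`**: a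
resolution of singularities is a tame resolution (`tameResolution_of_resolutionInChar`,
`PAlterationPialtTameKnownCases.lean`). So `TameResolutionInChar p` — the stub — is a consequence
of the summit conjunct at `p`, not a strengthening. [folklore] -/
theorem tameResolutionInChar_of_resolutionInChar {p : ℕ} (h : ResolutionInChar.{0} p) :
    TameResolutionInChar p := by
  intro k _ _ _ X f hs hl hq hi
  haveI := hs
  haveI := hl
  haveI := hq
  haveI := hi
  exact tameResolution_of_resolutionInChar h k X f

end Summit.ResolutionOfSingularities.ResolutionOfSingularities.Theorems.Pialt.RadiciallyRegular

end
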